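import Literature.AnabelianGeometry.AbsoluteAnabelian.AbsTopIII.BiAnabelianStarOverE

/-!
# [AbsTopIII] Cor. 3.7 (iii) — `K₀` on the whiskered type-(2) cell, under `ι_×` over Galois

[cite: MochizukiAbsTopIII2015, Cor 3.7 (iii) p.88] [cite: MochizukiAbsTopIII2015, Def 3.1 (iv) p.69]

abc-iut-L4-t5 (gen 5), row «COR37-COMPAT-LITERAL», groundwork for step (2) of
HOME/staging/L4/L4-t5/DISCHARGE-PLAN-Cor37-compat.md (the `𝔖†_log` conjunct of `RealisesCoresAndLogObs`): the
cross condition between the universal family `K₀` over `𝔈` and the observable `𝔖†_log` on its type-(2) generator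
`([λ^×]∘[γ], [λ^{×pf}]∘[γ])` whiskered into `𝔈`: under the hypothesis (H×) "`ι_×` lies over the canonical
identification of Galois groups" (`ι_× ▷ (𝒩 → 𝔈) = lamTimesGal ≫ lamTimesPfGal⁻¹`, objectwise; TRUE in the model,
`MLFLogFrobeniusIotaOverGalois`), `K₀`'s homotopy at `([toGal]∘[λ^×]∘[γ], [toGal]∘[λ^{×pf}]∘[γ])` IS `ι_× ▷ (𝒩 → 𝔈)`
behind `γ` — the homotopy the whiskering law of Def. 3.5 (ii) demands of any family containing `𝔖†_log`.
Proof-only; model-level; nothing here bears on [IUTchIII] Cor. 3.12.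
-/

set_option autoImplicit false

namespace Literature.AnabelianGeometry.AbsoluteAnabelian.AbsTopIII

open CategoryTheory Quiver
open Literature.AnabelianGeometry.AbsoluteAnabelian.DiagramOfCategories

universe u

namespace BiAnabelianSetting

variable {X E N : Type u} [Category.{u} X] [Category.{u} E] [Category.{u} N]
  (𝔖 : BiAnabelianSetting X E N)

/-- Along `λ^×` the augmentation 2-cell is `lamTimesGal`. [cite: MochizukiAbsTopIII2015, Cor 3.7 (i) p.87] -/
theorem overE_μ_lamTimes_hom_app (y : X) :
    (𝔖.overE.μ Cor37Edge.lamTimes).hom.app y = 𝔖.lamTimesGal.hom.app y := rfl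

/-- Along `λ^{×pf}` the augmentation 2-cell is `lamTimesPfGal`. [cite: MochizukiAbsTopIII2015, Cor 3.7 (i) p.87] -/
theorem overE_μ_lamTimesPf_hom_app (y : X) :
    (𝔖.overE.μ Cor37Edge.lamTimesPf).hom.app y = 𝔖.lamTimesPfGal.hom.app y := rfl

/-- Along `𝒩 → 𝔈` the augmentation 2-cell is the identity. [cite: MochizukiAbsTopIII2015, Cor 3.7 (i) p.87] -/
theorem overE_μ_toGal_hom_app (y : N) :
    (𝔖.overE.μ Cor37Edge.toGal).hom.app y = 𝟙 _ := rfl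

/-- `K₀`'s homotopy on a pair into `𝔈`, composed with the augmentation isomorphism of the right path, is the
augmentation isomorphism of the left path (the structure functor at `𝔈` is the identity).
[cite: MochizukiAbsTopIII2015, Cor 3.7 (ii) p.88] -/
theorem coresFamily_η_app_comp_pathIso {a : Cor37Vertex} (P Q : Path a .galois) (h : 𝔖.coresFamily.E P Q)
    (x : 𝔖.starDiagram.obj a) :
    (𝔖.coresFamily.η h).app x ≫ (𝔖.overE.pathIso Q).hom.app x = (𝔖.overE.pathIso P).hom.app x := by
  have hw : galoisVertex Cor37Vertex.galois := rfl
  have key := 𝔖.overE.map_lift_app (𝔖.galoisVertex_fullyFaithful _ hw) P Q x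
  rw [← univFamily_η_eq_lift 𝔖.overE galoisVertex 𝔖.galoisVertex_fullyFaithful hw P Q h] at key
  change (𝔖.coresFamily.η h).app x = _ at key
  rw [key]
  erw [Category.assoc, Iso.inv_hom_id_app]
  erw [Category.comp_id]

/-- **Cross condition on the type-(2) generator.** Under (H×), `K₀`'s homotopy at
`([toGal]∘[λ^×]∘[γ], [toGal]∘[λ^{×pf}]∘[γ])` is `(𝒩 → 𝔈)(ι_×)` behind `γ` (up to the `eqToHom`s of
`pathFunctor_cons`). [cite: MochizukiAbsTopIII2015, Cor 3.7 (iii) p.88] -/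
theorem coresFamily_η_timesGal_app
    (hι : ∀ y : X, 𝔖.spaceGal.map (𝔖.iotaTimes.app y) = 𝔖.lamTimesGal.hom.app y ≫ 𝔖.lamTimesPfGal.inv.app y)
    {a : Cor37Vertex} (γ : Path a .box)
    (h : 𝔖.coresFamily.E
      ((γ.cons (Cor37Edge.lamTimes.{u} : Cor37Vertex.box ⟶ .space)).cons
        (Cor37Edge.toGal.{u} : Cor37Vertex.space ⟶ .galois))
      ((γ.cons (Cor37Edge.lamTimesPf.{u} : Cor37Vertex.box ⟶ .space)).cons
        (Cor37Edge.toGal.{u} : Cor37Vertex.space ⟶ .galois)))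
    (x : 𝔖.starDiagram.obj a) :
    (𝔖.coresFamily.η h).app x =
      eqToHom (by rw [pathFunctor_cons, pathFunctor_cons]; rfl) ≫
        𝔖.spaceGal.map (𝔖.iotaTimes.app ((𝔖.starDiagram.pathFunctor γ).obj x)) ≫
        eqToHom (by rw [pathFunctor_cons, pathFunctor_cons]; rfl) := by
  refine (cancel_mono ((𝔖.overE.pathIso
    ((γ.cons (Cor37Edge.lamTimesPf.{u} : Cor37Vertex.box ⟶ .space)).cons
        (Cor37Edge.toGal.{u} : Cor37Vertex.space ⟶ .galois))).hom.app x)).1 ?_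
  refine (𝔖.coresFamily_η_app_comp_pathIso _ _ h x).trans ?_
  rw [OverData.pathIso_cons_app, OverData.pathIso_cons_app, OverData.pathIso_cons_app,
    OverData.pathIso_cons_app]
  rw [overE_μ_toGal_hom_app, overE_μ_toGal_hom_app, overE_μ_lamTimes_hom_app, overE_μ_lamTimesPf_hom_app]
  have hι' : ∀ y : X, 𝔖.lamTimesGal.hom.app y =
      𝔖.spaceGal.map (𝔖.iotaTimes.app y) ≫ 𝔖.lamTimesPfGal.hom.app y := fun y => by
    rw [hι]
    erw [Category.assoc, Iso.inv_hom_id_app]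
    erw [Category.comp_id]
  rw [hι']
  repeat erw [Category.assoc]
  repeat erw [Category.id_comp]
  repeat erw [eqToHom_trans_assoc]
  repeat erw [eqToHom_refl]
  repeat erw [Category.id_comp]
  rfl

end BiAnabelianSetting

end Literature.AnabelianGeometry.AbsoluteAnabelian.AbsTopIII
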